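import Mathlib.Topology.Instances.ZMod
import Mathlib.Topology.Algebra.Constructions
import Mathlib.Topology.Algebra.Group.Basic
import Mathlib.CategoryTheory.ObjectProperty.Equivalence
import Literature.AlgebraicGeometry.Frobenioids.BCatOrbits
import Literature.AlgebraicGeometry.Frobenioids.CategoryTypesEquivalenceTransport
import Literature.AlgebraicGeometry.Frobenioids.CoproductCompletionConnected
import Literature.IUT.HodgeTheaters.GlobalFrobenioidsBaseIdentify
import HarnessLib

/-!
# [IUTchI] Example 5.1 (iii), p. 125: the law binder `BaseCatRigid` is NOT a tautology of the interface —
# `ℬ(ℤ/3)⁰` has a self-equivalence (the inversion twist) that is not isomorphic to the identity (proof-only)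

S. Mochizuki, *Inter-universal Teichmüller theory I*, kurims manuscript (May 2020), §5, Example 5.1 (iii), p. 125
l. 50–57 ([IUTchI] Ex 5.1 (iii) p.125) [claim: Mochizuki2012, status: disputed]: the isomorphism
`Base(†ℱ^⊛) ⥲ †𝒟^⊛` is "uniquely determined, in light of the `F`-coricity of `C_F`, together with [AbsTopIII],
Theorem 1.9".  abc-iut-w5-d110 typed the bracket as `BaseCatRigid G` («every self-equivalence of `ℬ(G)⁰` is
isomorphic to the identity», `GlobalFrobenioidsBaseIdentify.lean`), witnessed it NON-VACUOUSLY at the trivial group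
(`GlobalFrobenioidsBaseCatRigidNonVacuity.lean`), and its docstring says «false for a general profinite group».
This file is the KERNEL FORM of that sentence (TIGHTNESS of the layer-5 certificate conjunct E51/L11,
`Summit.ABC.IUTFork.Conditional.layer5_held_ex51i_L11`): the binder carries content.

* `not_baseCatRigid_zmod_three` — for `G = ℤ/3` (discrete), restriction of finite continuous `G`-sets along the
  inversion automorphism `σ : g ↦ g⁻¹` (Mathlib `ContAction.resEquiv`, restricted to connected objects by
  `Equivalence.congrFullSubcategory`) is a self-equivalence `σ^*` of `ℬ(G)⁰` admitting NO isomorphism `σ^* ≅ 𝟭`: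
  at the regular object `T = G/1` (abc-iut-L1's `BCat.exists_coset_obj`) a component `α_T : σ^*T → T` is
  `σ`-twisted-equivariant, `α(g⁻¹·x) = g·α(x)`, and natural for the `G`-endomorphisms `x ↦ x·h` of `T`; the two
  together force `g² = 1` for every `g`, absurd in `ℤ/3`.
* `exists_not_baseCatRigid`, `not_forall_baseCatRigid` — hence the universal closure of the binder is FALSE and the
  law `h_Ex51i_BaseCatRigid` of the certificate is a genuine hypothesis (at the printed `π₁(†𝒟^⊛)` it is the
  content of `F`-coricity + [AbsTopIII] Thm 1.9 — after-merge; nothing is claimed about it here).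

PROOF-ONLY (no `def`, no `instance`, no new `Prop` fact); the toy `ℤ/3` is NOT an object of the disputed series;
refuting a universal closure says nothing about print; no side is taken on [IUTchIII] Cor. 3.12; typed ≠ proved.
-/

namespace Literature.IUT.HodgeTheaters

open CategoryTheory Literature.AlgebraicGeometry.Frobenioids
open scoped FintypeCatDiscrete

/-- **TIGHTNESS of the E51/L11 binder: `¬ BaseCatRigid (ℤ/3)`.**  The inversion twist `σ^*` on `ℬ(ℤ/3)⁰` is a
self-equivalence not isomorphic to the identity functor. ([IUTchI] Ex 5.1 (iii) p.125)
[claim: Mochizuki2012, status: disputed] -/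
theorem not_baseCatRigid_zmod_three : ¬ BaseCatRigid (ProfiniteGrp.of (Multiplicative (ZMod 3))) := by
  classical
  -- the group, its inversion automorphism (continuous: discrete topology), the twist equivalence of `ℬ(G)`
  let G : ProfiniteGrp.{0} := ProfiniteGrp.of (Multiplicative (ZMod 3))
  haveI : Finite G := Finite.of_equiv (ZMod 3) Multiplicative.ofAdd
  haveI : DiscreteTopology G := ⟨rfl⟩
  let σ : G ≃ₜ* G :=
    { MulEquiv.inv (Multiplicative (ZMod 3)) with
      continuous_toFun := continuous_of_discreteTopology
      continuous_invFun := continuous_of_discreteTopology }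
  have hσ : ∀ g : G, σ g = g⁻¹ := fun _ => rfl
  let e : BCat G ≌ BCat G := ContAction.resEquiv FintypeCat.{0} σ
  -- restriction to the connected objects `ℬ(G)⁰`
  haveI : (connectedObjects (BCat G)).IsClosedUnderIsomorphisms :=
    ⟨fun i h => IsConnectedObj.of_iso h i⟩
  have hP : (connectedObjects (BCat G)).inverseImage e.functor = connectedObjects (BCat G) := by
    funext A
    exact propext (isConnectedObj_map_equivalence_iff e A)
  let Φ : BaseCat G ≌ BaseCat G := Equivalence.congrFullSubcategory e hP
  -- suppose `σ^* ≅ 𝟭`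
  rintro ⟨hrig⟩
  obtain ⟨α⟩ := hrig Φ
  -- the regular object `T = G/1` of `ℬ(G)`: base point `q₀` with trivial stabiliser, transitive, mapping property
  obtain ⟨Q, q₀, hstab, htr, hmap⟩ := BCat.exists_coset_obj (G := G) ⊥ (isOpen_discrete _)
  have hQ : IsConnectedObj Q := BCat.isConnectedObj_of_transitive Q q₀ htr
  let T : BaseCat G := ⟨Q, hQ⟩
  -- freeness at `q₀`
  have hfree : ∀ g g' : G, g • q₀ = g' • q₀ → g = g' := fun g g' h => by
    have hmem : g'⁻¹ * g ∈ MulAction.stabilizer G q₀ := by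
      rw [MulAction.mem_stabilizer_iff, mul_smul, h, inv_smul_smul]
    rw [hstab, Subgroup.mem_bot] at hmem
    exact (eq_of_inv_mul_eq_one hmem).symm
  -- the component of `α` at `T`, as a function `a : Q → Q`
  let a : Q.obj.V → Q.obj.V := fun x => (α.hom.app T).hom.hom.hom x
  -- (E) twisted equivariance: `a (g⁻¹ • x) = g • a x`
  have hE : ∀ (g : G) (x : Q.obj.V), a (g⁻¹ • x) = g • a x := fun g x => by
    have hc := ConcreteCategory.congr_hom ((α.hom.app T).hom.hom.comm g) x
    simp only [FintypeCat.comp_apply] at hc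
    exact hc
  -- (N) naturality of `α` against the `G`-endomorphisms of `T`: `a ∘ b = b ∘ a`
  have hN : ∀ (b : Q ⟶ Q) (x : Q.obj.V), a (b.hom.hom x) = b.hom.hom (a x) := fun b x => by
    have hn := α.hom.naturality (ObjectProperty.homMk b : T ⟶ T)
    have hn' := congrArg (fun k => k.hom.hom.hom x) hn
    simp only [ObjectProperty.FullSubcategory.comp_hom, Action.comp_hom, FintypeCat.comp_apply,
      Functor.id_map] at hn'
    exact hn'
  -- a generator `g` of `ℤ/3`, the translation `b : q₀ ↦ g⁻¹ • q₀`, and `a q₀ = k • q₀`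
  let g : G := Multiplicative.ofAdd (1 : ZMod 3)
  obtain ⟨b, hb⟩ := hmap Q (g⁻¹ • q₀) bot_le
  obtain ⟨k, hk⟩ := htr (a q₀)
  have h1 : a (g⁻¹ • q₀) = g • a q₀ := hE g q₀
  have h2 : a (g⁻¹ • q₀) = b.hom.hom (a q₀) := by rw [← hb]; exact hN b q₀
  have h3 : b.hom.hom (a q₀) = (k * g⁻¹) • q₀ := by rw [← hk, BCat.hom_smul, hb, smul_smul]
  have h4 : g • a q₀ = (g * k) • q₀ := by rw [← hk, smul_smul]
  have h5 : g * k = k * g⁻¹ := hfree _ _ (by rw [← h4, ← h1, h2, h3])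
  have h6 : g * k = k * g := by
    show (g * k : Multiplicative (ZMod 3)) = k * g
    exact mul_comm _ _
  have h7 : g = g⁻¹ := mul_left_cancel (h6.symm.trans h5)
  -- but `1 ≠ -1` in `ℤ/3`
  have h8 : (1 : ZMod 3) = -1 := congrArg Multiplicative.toAdd h7
  exact absurd h8 (by decide)

/-- Some profinite group violates `BaseCatRigid`. ([IUTchI] Ex 5.1 (iii) p.125) [claim: Mochizuki2012, status: disputed] -/
theorem exists_not_baseCatRigid : ∃ G : ProfiniteGrp.{0}, ¬ BaseCatRigid G :=
  ⟨_, not_baseCatRigid_zmod_three⟩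

/-- **The universal closure of the E51/L11 binder is FALSE**: `BaseCatRigid` is a genuine hypothesis of the layer-5
certificate conjunct `layer5_held_ex51i_L11`, not a tautology of the typed interface (it holds at the trivial group,
`exists_baseCatRigid`, and fails at `ℤ/3`).  Nothing is claimed about the printed `π₁(†𝒟^⊛)`.
([IUTchI] Ex 5.1 (iii) p.125) [claim: Mochizuki2012, status: disputed] -/
theorem not_forall_baseCatRigid : ¬ ∀ G : ProfiniteGrp.{0}, BaseCatRigid G :=
  fun h => not_baseCatRigid_zmod_three (h _)

end Literature.IUT.HodgeTheaters
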